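import Summits.HodgeConjecture.HodgeConjecture.Cruxes.BlochSeedDiscOne.DepthBoundA4

/-!
# LeggedFloor — the FLOOR DESCENT: `(A4).2 ∧ RULE-D(P-side) ⇒ μ = 0` on every height-`h` alphabet
(plan-lens-HodgeAV-strengthen g15, STRENGTHEN-MEMO-24 §1; self-correction of STRENGTHEN-MEMO-23 §7)

Token: line stmt-HodgeConjecture-18881 Cruxes/BlochSeedDiscOne/Lines/birth.lean 814a6a70c14e831a stub_rung_pad4_seedAt.

LETTER-MODEL BOOKKEEPING ONLY (`DepthBoundA4.Design`); nothing here is a sheaf, a display or a SEED, and nothing here is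
proved toward HC ∕ HC_CM ∕ HC_AV ∕ №4 ∕ 26512 ∕ 18881 ∕ H2.  `Nonex 14 199 8` stays REFUTED as typed (`RotatedPairB136`).

## What is proved (sorry-free, `import` of the data model only; no `axiom` ∕ `instance` ∕ `unsafe` ∕ `native_decide`)

Write `A4N D` for the N-side half of `Design.A4` («every supported N-cell has a FOUR-AMPLE arrow in»,
`∀ y ∈ suppN, ∃ x ∈ suppP, Live x y`) and `LegAgree h D` for «every supported P-cell all of whose legs have level `< h`
agrees on each leg with some supported N-cell».  `LegAgree` is implied by the P-side clause `RuleDP` of RULE D (door (H2);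
text identical to idea-crit-hsem-3 g15 memo-152 `B136Door2Plate.RuleD`, second conjunct): a block avoiding the leg exists
and its supplier agrees with the cell off the block (`legAgree_of_ruleDP`).

* `descent` : on the height-`h` alphabet, under `A4N ∧ LegAgree`, every supported cell with all legs of level `< h` and
  every leg `g` admit a supported P-cell, again with all legs of level `< h`, whose leg `g` has STRICTLY SMALLER level
  (N-cell: its Live P-cell; P-cell: the Live P-cell under the N-cell that agrees with it on `g`).
* `no_fullBelow` : hence NO supported cell has all four legs of level `< h` (levels are `≥ 0` on the alphabet).
* `mu_eq_zero_of_a4N_legAgree` : a supported cell with a leg of level `≥ h` has that leg `= (h;0,0)` (β = 0), so its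
  Bloch coefficient `cellCoef · eeee = ∏ β̄` vanishes; both list sums of `T eeee` vanish termwise; `μ = 0`.
* `mu_eq_zero_of_a4N_ruleDP`, `mu_eq_zero_of_a4_ruleDP`, `legged_a4N_ruleDP_vacuous` : THE POINT — the hypothesis set
  «OnAlphabet h ∧ (A4).2 ∧ RuleD ∧ μ ≠ 0» is UNSATISFIABLE at every `h`, with no (A1), no Hall, no budget, no rank used.
* §2 `hubCornerP` ∕ `hubCornerN` ∕ `hub_corners` ∕ `no_full_of_hubless` : with DISJOINT supports, RULE D's two clauses chase
  each other (up from N-cells, down from P-cells, strictly in a block level-sum), so a room with one fully charged cell has,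
  for every leg pair, a P-cell AND an N-cell that are HUB on that pair; hubless rooms are empty.  (Structure for the
  enumeration seats; no (A1) ∕ Hall ∕ budget used.)

## Consequence for the audit (director-hodge R19.610 (5); officer's «re-typed as» column)
The statements `S⁺_sheaf + RuleD`, `S⁺_cycle(h)` of STRENGTHEN-MEMO-23 §7 and the re-typed `C″ := (A1) ∧ (A4).2 ∧ Hall ∧ RuleD ∧
μ ≠ 0 ∧ … ⇒ ⊥` are VACUOUSLY TRUE AS TYPED whenever «(A4).2» is read as the four-ample clause `A4N` (as MEMO-23 §6 (C1) and
§7 wrote it): the LEGGED room needs the N-side hygiene in its WEAK form — `CONN`'s second clause (a weakly-live arrow in,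
which RULE D's N-side suppliers already provide for every detecting cell) or an effective-arrow-in clause — and must NOT carry
`A4N`.  This is a typing correction caught before any stub was registered (R19.606 (2)(c)); it is not a statement about sheaves.
-/

set_option linter.dupNamespace false
set_option autoImplicit false

namespace Summit.HodgeConjecture.HodgeConjecture.Cruxes.BlochSeedDiscOne.LeggedFloor

open DepthBoundA4

/-- `(A4).2`, the N-side half of `Design.A4`: every supported N-cell has a FOUR-AMPLE (`Live`) arrow in. -/
def A4N (D : Design) : Prop := ∀ y ∈ D.suppN, ∃ x ∈ D.suppP, Live x y

theorem a4N_of_a4 (D : Design) (h : D.A4) : A4N D := h.2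

/-- All four legs of the cell have level `< h` (on the height-`h` alphabet: all four legs are charged, `β ≠ 0`). -/
def FullBelow (h : ℤ) (c : Cell) : Prop := ∀ f : Fin 4, (c f).a < h

/-- LEG AGREEMENT: every supported P-cell with all legs of level `< h` agrees, on each leg, with some supported N-cell. -/
def LegAgree (h : ℤ) (D : Design) : Prop :=
  ∀ x ∈ D.suppP, FullBelow h x → ∀ g : Fin 4, ∃ y ∈ D.suppN, y g = x g

/-! ## RULE D (door (H2)), P-side clause — text of idea-crit-hsem-3 g15 memo-152 `B136Door2Plate` -/

/-- NULL step on one factor: `a < a′` and `|β′ − β|² = (a′ − a)²`. -/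
def NullStep (ℓ ℓ' : Letter) : Prop :=
  ℓ.a < ℓ'.a ∧ (ℓ'.x - ℓ.x) ^ 2 + (ℓ'.y - ℓ.y) ^ 2 = (ℓ'.a - ℓ.a) ^ 2

/-- `x` (a P-cell) and `y` (an N-cell) form a SUPPLIER PAIR for the block `(g, j)`: equal off `{g, j}`, and on each of
`g`, `j` either EQUAL or a NULL step. -/
def Supplies (x y : Cell) (g j : Fin 4) : Prop :=
  (∀ f : Fin 4, f ≠ g → f ≠ j → x f = y f) ∧
    (x g = y g ∨ NullStep (x g) (y g)) ∧ (x j = y j ∨ NullStep (x j) (y j))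

/-- The `(g, j)` block of `ob_κ(c)` is nonzero for some `κ ∈ T_W`: NOT (`β_g = β_j = 0` and `a_g = a_j`). -/
def Detects (c : Cell) (g j : Fin 4) : Prop :=
  ¬ ((c g).x = 0 ∧ (c g).y = 0 ∧ (c j).x = 0 ∧ (c j).y = 0 ∧ (c g).a = (c j).a)

/-- RULE D, P-side clause: every detecting block of every supported P-cell is supplied by some supported N-cell. -/
def RuleDP (D : Design) : Prop :=
  ∀ x ∈ D.suppP, ∀ g j : Fin 4, g < j → Detects x g j → ∃ y ∈ D.suppN, Supplies x y g j

/-- RULE D (both sides), same text as memo-152. -/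
def RuleD (D : Design) : Prop :=
  (∀ y ∈ D.suppN, ∀ g j : Fin 4, g < j → Detects y g j → ∃ x ∈ D.suppP, Supplies x y g j) ∧ RuleDP D

theorem ruleDP_of_ruleD (D : Design) (h : RuleD D) : RuleDP D := h.2

/-! ## Alphabet bookkeeping -/

theorem level_le_of_onAlphabet {h : ℤ} {ℓ : Letter} (hℓ : ℓ.OnAlphabet h) : ℓ.a ≤ h := by
  have h1 := hℓ.1
  unfold Letter.height at h1
  have hx := abs_nonneg ℓ.x
  have hy := abs_nonneg ℓ.y
  linarith

theorem level_nonneg_of_onAlphabet {h : ℤ} {ℓ : Letter} (hℓ : ℓ.OnAlphabet h) : 0 ≤ ℓ.a := hℓ.2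

/-- A letter of the height-`h` alphabet whose level is not `< h` is the hub `(h; 0, 0)`: `x = y = 0`. -/
theorem xy_eq_zero_of_not_lt {h : ℤ} {ℓ : Letter} (hℓ : ℓ.OnAlphabet h) (hn : ¬ ℓ.a < h) :
    ℓ.x = 0 ∧ ℓ.y = 0 := by
  have h1 := hℓ.1
  unfold Letter.height at h1
  have hx := abs_nonneg ℓ.x
  have hy := abs_nonneg ℓ.y
  have hx0 : |ℓ.x| = 0 := by linarith
  have hy0 : |ℓ.y| = 0 := by linarith
  exact ⟨abs_eq_zero.mp hx0, abs_eq_zero.mp hy0⟩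

/-- A letter of level `< h` on the alphabet is charged: not `x = y = 0`. -/
theorem charged_of_lt {h : ℤ} {ℓ : Letter} (hℓ : ℓ.OnAlphabet h) (hlt : ℓ.a < h) : ¬ (ℓ.x = 0 ∧ ℓ.y = 0) := by
  rintro ⟨hx, hy⟩
  have h1 := hℓ.1
  unfold Letter.height at h1
  rw [hx, hy] at h1
  simp at h1
  linarith

theorem mem_supp_of_memP (D : Design) {x : Cell} (hx : x ∈ D.suppP) : x ∈ D.suppN ++ D.suppP :=
  List.mem_append_right _ hx

theorem mem_supp_of_memN (D : Design) {y : Cell} (hy : y ∈ D.suppN) : y ∈ D.suppN ++ D.suppP :=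
  List.mem_append_left _ hy

/-! ## RULE D (P-side) gives leg agreement -/

/-- For each leg `g` a block `(j, j′)`, `j < j′`, avoiding `g`. -/
theorem exists_block_avoiding (g : Fin 4) : ∃ j j' : Fin 4, j < j' ∧ g ≠ j ∧ g ≠ j' := by
  fin_cases g
  · exact ⟨1, 2, by decide, by decide, by decide⟩
  · exact ⟨2, 3, by decide, by decide, by decide⟩
  · exact ⟨0, 1, by decide, by decide, by decide⟩
  · exact ⟨0, 1, by decide, by decide, by decide⟩

theorem legAgree_of_ruleDP (h : ℤ) (D : Design) (hD : D.OnAlphabet h) (hr : RuleDP D) : LegAgree h D := by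
  intro x hx hfull g
  obtain ⟨j, j', hjj, hgj, hgj'⟩ := exists_block_avoiding g
  have hdet : Detects x j j' := by
    intro hc
    exact charged_of_lt (hD x (mem_supp_of_memP D hx) j) (hfull j) ⟨hc.1, hc.2.1⟩
  obtain ⟨y, hy, hsup⟩ := hr x hx j j' hjj hdet
  exact ⟨y, hy, (hsup.1 g hgj hgj').symm⟩

/-! ## The floor descent -/

/-- One step down: every fully-charged supported cell and every leg `g` admit a fully-charged supported P-cell whose leg `g`
has strictly smaller level. -/
theorem descent (h : ℤ) (D : Design) (hD : D.OnAlphabet h) (hA : A4N D) (hL : LegAgree h D)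
    (c : Cell) (hc : c ∈ D.suppN ++ D.suppP) (hfull : FullBelow h c) (g : Fin 4) :
    ∃ c' ∈ D.suppP, FullBelow h c' ∧ (c' g).a < (c g).a := by
  rcases List.mem_append.mp hc with hN | hP
  · obtain ⟨x, hx, hlive⟩ := hA c hN
    refine ⟨x, hx, fun f => lt_trans (hlive f).1 (hfull f), (hlive g).1⟩
  · obtain ⟨y, hy, hyg⟩ := hL c hP hfull g
    obtain ⟨x, hx, hlive⟩ := hA y hy
    refine ⟨x, hx, fun f => lt_of_lt_of_le (hlive f).1 ?_, ?_⟩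
    · exact level_le_of_onAlphabet (hD y (mem_supp_of_memN D hy) f)
    · have := (hlive g).1
      rw [hyg] at this
      exact this

/-- No supported cell has all four legs of level `< h`. -/
theorem no_fullBelow (h : ℤ) (D : Design) (hD : D.OnAlphabet h) (hA : A4N D) (hL : LegAgree h D)
    (c : Cell) (hc : c ∈ D.suppN ++ D.suppP) : ¬ FullBelow h c := by
  suffices key : ∀ n : ℕ, ∀ c ∈ D.suppN ++ D.suppP, FullBelow h c → ((c 0).a < (n : ℤ)) → False by
    intro hfull
    have h0 : (c 0).a < h := hfull 0
    have hn : h ≤ ((h.toNat : ℕ) : ℤ) := Int.self_le_toNat h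
    exact key h.toNat c hc hfull (lt_of_lt_of_le h0 hn)
  intro n
  induction n with
  | zero =>
    intro c hc _ hlt
    have h0 := level_nonneg_of_onAlphabet (hD c hc 0)
    push_cast at hlt
    linarith
  | succ n ih =>
    intro c hc hfull hlt
    obtain ⟨c', hc', hfull', hlt'⟩ := descent h D hD hA hL c hc hfull 0
    refine ih c' (mem_supp_of_memP D hc') hfull' ?_
    push_cast at hlt
    linarith

/-! ## No fully-charged cell ⇒ `μ = 0` -/

/-- A cell on the alphabet that is not fully charged has a hub leg, hence zero Bloch coefficient. -/
theorem cellCoef_eeee_eq_zero_of_not_full {h : ℤ} {c : Cell} (hc : ∀ f : Fin 4, (c f).OnAlphabet h)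
    (hn : ¬ FullBelow h c) : cellCoef c Word.eeee = 0 := by
  unfold FullBelow at hn
  obtain ⟨f, hf⟩ := not_forall.mp hn
  have hxy := xy_eq_zero_of_not_lt (hc f) hf
  have hb : (c f).beta = 0 := by
    ext <;> simp [Letter.beta, hxy.1, hxy.2]
  rw [cellCoef]
  apply Finset.prod_eq_zero (Finset.mem_univ f)
  simp [Word.eeee, Sym.coef, hb]

theorem listSum_eeee_eq_zero (L : List (Cell × ℕ))
    (hL : ∀ cm ∈ L, 0 < cm.2 → cellCoef cm.1 Word.eeee = 0) :
    (L.map fun cm => (cm.2 : GaussianInt) * cellCoef cm.1 Word.eeee).sum = 0 := by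
  apply List.sum_eq_zero
  intro t ht
  rw [List.mem_map] at ht
  obtain ⟨cm, hcm, rfl⟩ := ht
  by_cases h0 : 0 < cm.2
  · rw [hL cm hcm h0, mul_zero]
  · have : cm.2 = 0 := by omega
    rw [this]; simp

/-- THE FLOOR THEOREM: on the height-`h` alphabet, `(A4).2 ∧ LegAgree ⇒ μ = 0`. -/
theorem mu_eq_zero_of_a4N_legAgree (h : ℤ) (D : Design) (hD : D.OnAlphabet h) (hA : A4N D) (hL : LegAgree h D) :
    D.mu = 0 := by
  have hN : (D.N.map fun cm => (cm.2 : GaussianInt) * cellCoef cm.1 Word.eeee).sum = 0 := by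
    apply listSum_eeee_eq_zero
    intro cm hcm h0
    have hmem : cm.1 ∈ D.suppN :=
      List.mem_map.mpr ⟨cm, List.mem_filter.mpr ⟨hcm, by simpa using h0⟩, rfl⟩
    have hsupp := mem_supp_of_memN D hmem
    exact cellCoef_eeee_eq_zero_of_not_full (hD cm.1 hsupp) (no_fullBelow h D hD hA hL cm.1 hsupp)
  have hP : (D.P.map fun cm => (cm.2 : GaussianInt) * cellCoef cm.1 Word.eeee).sum = 0 := by
    apply listSum_eeee_eq_zero
    intro cm hcm h0
    have hmem : cm.1 ∈ D.suppP :=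
      List.mem_map.mpr ⟨cm, List.mem_filter.mpr ⟨hcm, by simpa using h0⟩, rfl⟩
    have hsupp := mem_supp_of_memP D hmem
    exact cellCoef_eeee_eq_zero_of_not_full (hD cm.1 hsupp) (no_fullBelow h D hD hA hL cm.1 hsupp)
  show D.T Word.eeee = 0
  rw [Design.T, hN, hP, sub_zero]

/-- `(A4).2 ∧ RuleD(P-side) ⇒ μ = 0`, at every height. -/
theorem mu_eq_zero_of_a4N_ruleDP (h : ℤ) (D : Design) (hD : D.OnAlphabet h) (hA : A4N D) (hr : RuleDP D) :
    D.mu = 0 :=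
  mu_eq_zero_of_a4N_legAgree h D hD hA (legAgree_of_ruleDP h D hD hr)

/-- `(A4) ∧ RuleD(P-side) ⇒ μ = 0`. -/
theorem mu_eq_zero_of_a4_ruleDP (h : ℤ) (D : Design) (hD : D.OnAlphabet h) (hA : D.A4) (hr : RuleDP D) :
    D.mu = 0 :=
  mu_eq_zero_of_a4N_ruleDP h D hD (a4N_of_a4 D hA) hr

/-- `(A4).2 ∧ RuleD ⇒ μ = 0`. -/
theorem mu_eq_zero_of_a4N_ruleD (h : ℤ) (D : Design) (hD : D.OnAlphabet h) (hA : A4N D) (hr : RuleD D) :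
    D.mu = 0 :=
  mu_eq_zero_of_a4N_ruleDP h D hD hA (ruleDP_of_ruleD D hr)

/-- VACUITY of the legged statements as typed with `(A4).2 := A4N`: the hypotheses `OnAlphabet h`, `A4N`, `RuleDP`, `μ ≠ 0`
are jointly unsatisfiable (no (A1), Hall, copies, rank or budget hypothesis is used). -/
theorem legged_a4N_ruleDP_vacuous (h : ℤ) (D : Design) (hD : D.OnAlphabet h) (hA : A4N D) (hr : RuleDP D)
    (hμ : D.mu ≠ 0) : False :=
  hμ (mu_eq_zero_of_a4N_ruleDP h D hD hA hr)

/-! ## HUB CORNERS — what RULE D forces on BOTH sides once supports are disjoint (STRENGTHEN-MEMO-24 §2)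

With DISJOINT supports (minimal display: no cell on both sides) the two supplier clauses chase each other: from an N-cell,
its `(g,j)`-supplier is a P-cell with the same complementary legs `(g′,j′)`, whose `(g′,j′)`-supplier is an N-cell with
STRICTLY larger `(g′,j′)`-level-sum — so the chase climbs until the complementary legs are both the hub `(h;0,0)` (the only
non-detecting block).  Dually, from a P-cell the chase descends in `(g′,j′)`-level-sum and can only stop when the `(g,j)` legs
reach the hub.  Consequently a legged room containing ONE fully charged cell contains, for EACH of the six leg pairs, a
P-cell AND an N-cell that are hub on that pair (`hub_corners`).  Hubless rooms are empty. -/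

/-- Disjoint supports (a minimal two-term display: no cell occurs on both sides). -/
def Disj (D : Design) : Prop := ∀ c : Cell, c ∈ D.suppN → c ∈ D.suppP → False

/-- At least one of the legs `g`, `j` has level `< h` (on the alphabet: the block `(g,j)` detects). -/
def LowPair (h : ℤ) (c : Cell) (g j : Fin 4) : Prop := (c g).a < h ∨ (c j).a < h

/-- Both legs `g`, `j` have level `≥ h` (on the alphabet: both are the hub `(h;0,0)`). -/
def HubPair (h : ℤ) (c : Cell) (g j : Fin 4) : Prop := ¬ (c g).a < h ∧ ¬ (c j).a < h

theorem lowPair_of_not_hubPair {h : ℤ} {c : Cell} {g j : Fin 4} (hn : ¬ HubPair h c g j) : LowPair h c g j := by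
  unfold HubPair at hn; unfold LowPair; tauto

theorem detects_of_lowPair {h : ℤ} {c : Cell} (hc : ∀ f : Fin 4, (c f).OnAlphabet h) {g j : Fin 4}
    (hl : LowPair h c g j) : Detects c g j := by
  intro hdet
  rcases hl with hg | hj
  · exact charged_of_lt (hc g) hg ⟨hdet.1, hdet.2.1⟩
  · exact charged_of_lt (hc j) hj ⟨hdet.2.2.1, hdet.2.2.2.1⟩

theorem level_le_of_eq_or_null {ℓ ℓ' : Letter} (h : ℓ = ℓ' ∨ NullStep ℓ ℓ') : ℓ.a ≤ ℓ'.a := by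
  rcases h with h | h
  · rw [h]
  · exact le_of_lt h.1

/-- A supplier pair that is not the same cell moves the block's level-sum STRICTLY. -/
theorem levelSum_lt_of_supplies_ne {x y : Cell} {g j : Fin 4} (hs : Supplies x y g j) (hne : x ≠ y) :
    (x g).a + (x j).a < (y g).a + (y j).a := by
  obtain ⟨hoff, hg, hj⟩ := hs
  have hg' := level_le_of_eq_or_null hg
  have hj' := level_le_of_eq_or_null hj
  by_contra hcon
  apply hne
  funext f
  by_cases hfg : f = g
  · subst hfg
    rcases hg with h | h
    · exact h
    · exfalso; have := h.1; omega
  by_cases hfj : f = j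
  · subst hfj
    rcases hj with h | h
    · exact h
    · exfalso; have := h.1; omega
  exact hoff f hfg hfj

/-- CHASE UP (from N-cells): an N-cell whose block `(g,j)` detects forces a P-cell that is hub on the complement `(g′,j′)`. -/
theorem hubCornerP (h : ℤ) (D : Design) (hD : D.OnAlphabet h) (hr : RuleD D) (hdis : Disj D)
    (g j g' j' : Fin 4) (hgj : g < j) (hg'j' : g' < j')
    (h1 : g ≠ g') (h2 : g ≠ j') (h3 : j ≠ g') (h4 : j ≠ j') :
    ∀ y ∈ D.suppN, LowPair h y g j → ∃ x ∈ D.suppP, HubPair h x g' j' := by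
  suffices key : ∀ n : ℕ, ∀ y ∈ D.suppN, LowPair h y g j →
      (h - (y g').a) + (h - (y j').a) < (n : ℤ) → ∃ x ∈ D.suppP, HubPair h x g' j' by
    intro y hy hl
    refine key (((h - (y g').a) + (h - (y j').a)).toNat + 1) y hy hl ?_
    have := Int.self_le_toNat ((h - (y g').a) + (h - (y j').a))
    push_cast
    linarith
  intro n
  induction n with
  | zero =>
    intro y hy _ hlt
    have a1 := level_le_of_onAlphabet (hD y (mem_supp_of_memN D hy) g')
    have a2 := level_le_of_onAlphabet (hD y (mem_supp_of_memN D hy) j')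
    push_cast at hlt
    linarith
  | succ n ih =>
    intro y hy hl hlt
    have hyA : ∀ f : Fin 4, (y f).OnAlphabet h := hD y (mem_supp_of_memN D hy)
    obtain ⟨x, hx, hs⟩ := hr.1 y hy g j hgj (detects_of_lowPair hyA hl)
    by_cases hhub : HubPair h x g' j'
    · exact ⟨x, hx, hhub⟩
    have hxA : ∀ f : Fin 4, (x f).OnAlphabet h := hD x (mem_supp_of_memP D hx)
    have hlx : LowPair h x g' j' := lowPair_of_not_hubPair hhub
    obtain ⟨y', hy', hs'⟩ := hr.2 x hx g' j' hg'j' (detects_of_lowPair hxA hlx)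
    have hne : x ≠ y' := fun heq => hdis x (heq ▸ hy') hx
    have hstrict := levelSum_lt_of_supplies_ne hs' hne
    -- x agrees with y on the complement (g', j')
    have hxg' : x g' = y g' := hs.1 g' h1.symm h3.symm
    have hxj' : x j' = y j' := hs.1 j' h2.symm h4.symm
    -- y' agrees with x on (g, j), and x ≤ y there
    have hy'g : y' g = x g := (hs'.1 g h1 h2).symm
    have hy'j : y' j = x j := (hs'.1 j h3 h4).symm
    have hl' : LowPair h y' g j := by
      rcases hl with hgl | hjl
      · left; rw [hy'g]; exact lt_of_le_of_lt (level_le_of_eq_or_null hs.2.1) hgl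
      · right; rw [hy'j]; exact lt_of_le_of_lt (level_le_of_eq_or_null hs.2.2) hjl
    refine ih y' hy' hl' ?_
    rw [hxg', hxj'] at hstrict
    push_cast at hlt
    linarith

/-- CHASE DOWN (from P-cells): a P-cell whose blocks `(g,j)` and `(g′,j′)` both detect forces an N-cell that is hub on `(g,j)`. -/
theorem hubCornerN (h : ℤ) (D : Design) (hD : D.OnAlphabet h) (hr : RuleD D) (hdis : Disj D)
    (g j g' j' : Fin 4) (hgj : g < j) (hg'j' : g' < j')
    (h1 : g ≠ g') (h2 : g ≠ j') (h3 : j ≠ g') (h4 : j ≠ j') :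
    ∀ x ∈ D.suppP, LowPair h x g j → LowPair h x g' j' → ∃ y ∈ D.suppN, HubPair h y g j := by
  suffices key : ∀ n : ℕ, ∀ x ∈ D.suppP, LowPair h x g j → LowPair h x g' j' →
      (x g').a + (x j').a < (n : ℤ) → ∃ y ∈ D.suppN, HubPair h y g j by
    intro x hx hl hl'
    refine key (((x g').a + (x j').a).toNat + 1) x hx hl hl' ?_
    have := Int.self_le_toNat ((x g').a + (x j').a)
    push_cast
    linarith
  intro n
  induction n with
  | zero =>
    intro x hx _ _ hlt
    have a1 := level_nonneg_of_onAlphabet (hD x (mem_supp_of_memP D hx) g')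
    have a2 := level_nonneg_of_onAlphabet (hD x (mem_supp_of_memP D hx) j')
    push_cast at hlt
    linarith
  | succ n ih =>
    intro x hx hl hl' hlt
    have hxA : ∀ f : Fin 4, (x f).OnAlphabet h := hD x (mem_supp_of_memP D hx)
    obtain ⟨y, hy, hs⟩ := hr.2 x hx g j hgj (detects_of_lowPair hxA hl)
    by_cases hhub : HubPair h y g j
    · exact ⟨y, hy, hhub⟩
    have hyA : ∀ f : Fin 4, (y f).OnAlphabet h := hD y (mem_supp_of_memN D hy)
    have hly : LowPair h y g j := lowPair_of_not_hubPair hhub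
    -- y agrees with x on the complement (g', j'), so that block of y detects
    have hyg' : y g' = x g' := (hs.1 g' h1.symm h3.symm).symm
    have hyj' : y j' = x j' := (hs.1 j' h2.symm h4.symm).symm
    have hly' : LowPair h y g' j' := by
      rcases hl' with a | b
      · left; rw [hyg']; exact a
      · right; rw [hyj']; exact b
    obtain ⟨x', hx', hs'⟩ := hr.1 y hy g' j' hg'j' (detects_of_lowPair hyA hly')
    have hne : x' ≠ y := fun heq => hdis y hy (heq ▸ hx')
    have hstrict := levelSum_lt_of_supplies_ne hs' hne
    -- x' agrees with y on (g, j)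
    have hx'g : x' g = y g := hs'.1 g h1 h2
    have hx'j : x' j = y j := hs'.1 j h3 h4
    have hlx' : LowPair h x' g j := by
      rcases hly with a | b
      · left; rw [hx'g]; exact a
      · right; rw [hx'j]; exact b
    have hlx'' : LowPair h x' g' j' := by
      rcases hly' with a | b
      · left; exact lt_of_le_of_lt (level_le_of_eq_or_null hs'.2.1) a
      · right; exact lt_of_le_of_lt (level_le_of_eq_or_null hs'.2.2) b
    refine ih x' hx' hlx' hlx'' ?_
    rw [hyg', hyj'] at hstrict
    push_cast at hlt
    linarith

/-- A fully charged supported cell yields a fully charged supported P-cell (itself, or any of its suppliers). -/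
theorem exists_fullP (h : ℤ) (D : Design) (hD : D.OnAlphabet h) (hr : RuleD D)
    (c : Cell) (hc : c ∈ D.suppN ++ D.suppP) (hfull : FullBelow h c) :
    ∃ x ∈ D.suppP, FullBelow h x := by
  rcases List.mem_append.mp hc with hN | hP
  · have hcA : ∀ f : Fin 4, (c f).OnAlphabet h := hD c hc
    obtain ⟨x, hx, hs⟩ := hr.1 c hN 0 1 (by decide) (detects_of_lowPair hcA (Or.inl (hfull 0)))
    refine ⟨x, hx, fun f => ?_⟩
    by_cases hf0 : f = 0
    · subst hf0; exact lt_of_le_of_lt (level_le_of_eq_or_null hs.2.1) (hfull 0)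
    by_cases hf1 : f = 1
    · subst hf1; exact lt_of_le_of_lt (level_le_of_eq_or_null hs.2.2) (hfull 1)
    rw [hs.1 f hf0 hf1]; exact hfull f
  · exact ⟨c, hP, hfull⟩

/-- HUB CORNERS: in a RULE-D room with disjoint supports containing one fully charged cell, every leg pair `(g,j)` (given
with its complement `(g′,j′)`) is the hub pair of some supported P-cell AND of some supported N-cell. -/
theorem hub_corners (h : ℤ) (D : Design) (hD : D.OnAlphabet h) (hr : RuleD D) (hdis : Disj D)
    (c : Cell) (hc : c ∈ D.suppN ++ D.suppP) (hfull : FullBelow h c)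
    (g j g' j' : Fin 4) (hgj : g < j) (hg'j' : g' < j')
    (h1 : g ≠ g') (h2 : g ≠ j') (h3 : j ≠ g') (h4 : j ≠ j') :
    (∃ x ∈ D.suppP, HubPair h x g j) ∧ (∃ y ∈ D.suppN, HubPair h y g j) := by
  obtain ⟨x₀, hx₀, hfx⟩ := exists_fullP h D hD hr c hc hfull
  have hx₀A : ∀ f : Fin 4, (x₀ f).OnAlphabet h := hD x₀ (mem_supp_of_memP D hx₀)
  refine ⟨?_, ?_⟩
  · -- the (g,j)-supplier of x₀ is an N-cell with low complement (g',j'); chase up from it with the pairs swapped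
    obtain ⟨y, hy, hs⟩ := hr.2 x₀ hx₀ g j hgj (detects_of_lowPair hx₀A (Or.inl (hfx g)))
    have hly : LowPair h y g' j' := by
      left; rw [← hs.1 g' h1.symm h3.symm]; exact hfx g'
    exact hubCornerP h D hD hr hdis g' j' g j hg'j' hgj h1.symm h3.symm h2.symm h4.symm y hy hly
  · exact hubCornerN h D hD hr hdis g j g' j' hgj hg'j' h1 h2 h3 h4 x₀ hx₀
      (Or.inl (hfx g)) (Or.inl (hfx g'))

/-- HUBLESS ROOMS ARE EMPTY: if no supported N-cell has a hub pair of legs, a RULE-D room with disjoint supports has no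
fully charged cell (hence `μ = 0`, cf. `cellCoef_eeee_eq_zero_of_not_full`). -/
theorem no_full_of_hubless (h : ℤ) (D : Design) (hD : D.OnAlphabet h) (hr : RuleD D) (hdis : Disj D)
    (hno : ∀ y ∈ D.suppN, ∀ g j : Fin 4, g < j → LowPair h y g j)
    (c : Cell) (hc : c ∈ D.suppN ++ D.suppP) : ¬ FullBelow h c := by
  intro hfull
  obtain ⟨_, ⟨y, hy, hhub⟩⟩ := hub_corners h D hD hr hdis c hc hfull 0 1 2 3 (by decide) (by decide)
    (by decide) (by decide) (by decide) (by decide)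
  have := hno y hy 0 1 (by decide)
  unfold HubPair at hhub; unfold LowPair at this; tauto

/-! ## The predicate `LegAgree` has content off `A4N`: a legged pair (sanity `example`, height 9) -/

/-- The memo-152 legged pair: P-cell `x = ((0;4,5), t, t, t)` and N-cell `y = ((4;4,1), t, t, t)`, `t = (2;−4,3)`:
`Supplies x y 0 1` (factor 0 NULL, factors 1–3 equal), so `y` agrees with `x` on legs 1, 2, 3 — but NOT on leg 0, and no cell
here is Live under anything: the descent needs `A4N`, which this two-cell room does not have. -/
example :
    let t : Letter := ⟨2, -4, 3⟩
    let x : Cell := fun f => if f = 0 then ⟨0, 4, 5⟩ else t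
    let y : Cell := fun f => if f = 0 then ⟨4, 4, 1⟩ else t
    Supplies x y 0 1 ∧ ¬ Live x y := by
  refine ⟨?_, ?_⟩
  · unfold Supplies NullStep; decide
  · intro hl
    have := (hl 1).1
    simp at this

end Summit.HodgeConjecture.HodgeConjecture.Cruxes.BlochSeedDiscOne.LeggedFloor
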